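import Mathlib
import HarnessLib

/-!
# Total-variation closeness of Gibbs tilts under a sup-small perturbation

Pure measure theory used by Dobrushin's uniqueness technique in the total-variation form
(Föllmer LNM 1362 (1988) Ch. I, Remark (2.17): for the discrete metric the Vasserstein coefficient
is `½‖γ_x(·|ω) − γ_x(·|η)‖`; Georgii 2011, Prop. 8.8; Simon, *The Statistical Mechanics of Lattice
Gases* (1993), §V.1): if two tilting functions differ by at most `ε` up to an additive constant,
`|h₁ − h₂ − κ| ≤ ε`, the tilted probability measures `μ^{h₁}, μ^{h₂}` (densities `e^{hᵢ}/μ(e^{hᵢ})`)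
have density ratio in `[e^{-2ε}, e^{2ε}]`, hence total variation `≤ ½(e^{2ε} − 1)`, hence
`|μ^{h₁}(φ) − μ^{h₂}(φ)| ≤ ½(e^{2ε} − 1) · osc φ` for bounded measurable `φ`.

## References
* H. Föllmer, LNM 1362 (1988), Ch. I, Remark (2.17).
* H.-O. Georgii, *Gibbs Measures and Phase Transitions*, 2nd ed. (2011), Prop. 8.8.
-/

noncomputable section

open MeasureTheory Real

namespace Literature.Probability.LatticeModels.DobrushinMetric

variable {S : Type*} [MeasurableSpace S]

/-- `exp` of a bounded measurable function is integrable for a finite measure. [folklore] -/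
lemma integrable_exp_of_abs_le (μ : Measure S) [IsFiniteMeasure μ] {h : S → ℝ}
    (hm : Measurable h) (hb : ∃ B, ∀ s, |h s| ≤ B) : Integrable (fun s => exp (h s)) μ := by
  obtain ⟨B, hB⟩ := hb
  refine Integrable.of_bound hm.exp.aestronglyMeasurable (exp B) (ae_of_all _ fun s => ?_)
  rw [Real.norm_eq_abs, abs_exp]
  exact exp_le_exp.mpr (abs_le.mp (hB s)).2

/-- Normalized `exp`-densities with `ε`-close exponents differ by `≤ (e^{2ε}-1)·p₂`. [folklore] -/
lemma abs_exp_div_sub_exp_div_le {Z₁ Z₂ a b κ ε : ℝ} (hZ₁ : 0 < Z₁) (hZ₂ : 0 < Z₂)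
    (hab : |a - b - κ| ≤ ε) (hZl : exp (κ - ε) * Z₂ ≤ Z₁) (hZu : Z₁ ≤ exp (κ + ε) * Z₂) :
    |exp a / Z₁ - exp b / Z₂| ≤ (exp (2 * ε) - 1) * (exp b / Z₂) := by
  have hq : 0 ≤ exp b / Z₂ := div_nonneg (exp_pos _).le hZ₂.le
  have hup : exp a ≤ exp (κ + ε) * exp b := by
    rw [← exp_add, exp_le_exp]
    have := (abs_le.mp hab).2
    linarith
  have hlo : exp (κ - ε) * exp b ≤ exp a := by
    rw [← exp_add, exp_le_exp]
    have := (abs_le.mp hab).1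
    linarith
  -- upper ratio bound
  have h1 : exp a / Z₁ ≤ exp (2 * ε) * (exp b / Z₂) := by
    rw [div_le_iff₀ hZ₁]
    calc exp a ≤ exp (κ + ε) * exp b := hup
      _ = exp (2 * ε) * exp b * exp (κ - ε) := by
          rw [show κ + ε = 2 * ε + (κ - ε) by ring, exp_add]; ring
      _ ≤ exp (2 * ε) * exp b * (Z₁ / Z₂) := by
          gcongr
          rwa [le_div_iff₀ hZ₂]
      _ = exp (2 * ε) * (exp b / Z₂) * Z₁ := by ring
  -- lower ratio bound
  have h2 : exp (-(2 * ε)) * (exp b / Z₂) ≤ exp a / Z₁ := by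
    rw [le_div_iff₀ hZ₁]
    have hee : exp (-(2 * ε)) * exp (κ + ε) = exp (κ - ε) := by
      rw [← exp_add]; ring_nf
    calc exp (-(2 * ε)) * (exp b / Z₂) * Z₁
        ≤ exp (-(2 * ε)) * (exp b / Z₂) * (exp (κ + ε) * Z₂) := by gcongr
      _ = exp (-(2 * ε)) * exp (κ + ε) * exp b * (Z₂ / Z₂) := by ring
      _ = exp (κ - ε) * exp b := by rw [hee, div_self hZ₂.ne', mul_one]
      _ ≤ exp a := hlo
  have hamgm : 2 * (exp b / Z₂) ≤ (exp (2 * ε) + exp (-(2 * ε))) * (exp b / Z₂) :=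
    mul_le_mul_of_nonneg_right
      (by linarith [add_one_le_exp (2 * ε), add_one_le_exp (-(2 * ε))]) hq
  rw [abs_le]
  constructor
  · nlinarith [h2, hamgm]
  · linarith [h1]

omit [MeasurableSpace S] in
/-- A bounded real function with oscillation `≤ L` is within `L/2` of a constant. [folklore] -/
lemma exists_forall_abs_sub_le_half {φ : S → ℝ} (hφb : ∃ M, ∀ s, |φ s| ≤ M) {L : ℝ}
    (hφL : ∀ a b, |φ a - φ b| ≤ L) : ∃ m, ∀ s, |φ s - m| ≤ L / 2 := by
  obtain ⟨M, hM⟩ := hφb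
  have hbdd : BddAbove (Set.range φ) := ⟨M, by rintro _ ⟨s, rfl⟩; exact (abs_le.mp (hM s)).2⟩
  refine ⟨(⨆ a, φ a) - L / 2, fun s => ?_⟩
  haveI : Nonempty S := ⟨s⟩
  have h1 : φ s ≤ ⨆ a, φ a := le_ciSup hbdd s
  have h2 : (⨆ a, φ a) ≤ φ s + L :=
    ciSup_le fun a => by have := (abs_le.mp (hφL a s)).2; linarith
  rw [abs_le]
  constructor <;> linarith

/-- If `|p₁ − p₂| ≤ δ p₂`, `∫ pᵢ = 1`, `|φ − m| ≤ L/2` then `|∫ p₁φ − ∫ p₂φ| ≤ δL/2`. [folklore] -/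
lemma abs_integral_mul_sub_integral_mul_le (μ : Measure S) {p₁ p₂ φ : S → ℝ}
    (hp₁ : Integrable p₁ μ) (hp₂ : Integrable p₂ μ)
    (hp₁φ : Integrable (fun s => p₁ s * φ s) μ) (hp₂φ : Integrable (fun s => p₂ s * φ s) μ)
    (hp₁1 : ∫ s, p₁ s ∂μ = 1) (hp₂1 : ∫ s, p₂ s ∂μ = 1)
    {δ : ℝ} (hp : ∀ s, |p₁ s - p₂ s| ≤ δ * p₂ s)
    {m L : ℝ} (hm : ∀ s, |φ s - m| ≤ L / 2) :
    |∫ s, p₁ s * φ s ∂μ - ∫ s, p₂ s * φ s ∂μ| ≤ δ / 2 * L := by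
  have hfun : (fun s => (p₁ s - p₂ s) * (φ s - m))
      = fun s => (p₁ s * φ s - p₂ s * φ s) - m * (p₁ s - p₂ s) := by
    funext s; ring
  have hint : Integrable (fun s => (p₁ s - p₂ s) * (φ s - m)) μ := by
    rw [hfun]
    exact (hp₁φ.sub' hp₂φ).sub' ((hp₁.sub' hp₂).const_mul m)
  have key : ∫ s, p₁ s * φ s ∂μ - ∫ s, p₂ s * φ s ∂μ = ∫ s, (p₁ s - p₂ s) * (φ s - m) ∂μ := by
    rw [hfun, integral_sub (hp₁φ.sub' hp₂φ) ((hp₁.sub' hp₂).const_mul m), integral_sub hp₁φ hp₂φ,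
      integral_const_mul, integral_sub hp₁ hp₂, hp₁1, hp₂1]
    ring
  rw [key]
  calc |∫ s, (p₁ s - p₂ s) * (φ s - m) ∂μ| ≤ ∫ s, |(p₁ s - p₂ s) * (φ s - m)| ∂μ :=
        abs_integral_le_integral_abs
    _ ≤ ∫ s, (δ * (L / 2)) * p₂ s ∂μ := by
        refine integral_mono hint.abs (hp₂.const_mul _) fun s => ?_
        show |(p₁ s - p₂ s) * (φ s - m)| ≤ (δ * (L / 2)) * p₂ s
        rw [abs_mul]
        calc |p₁ s - p₂ s| * |φ s - m| ≤ (δ * p₂ s) * (L / 2) :=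
              mul_le_mul (hp s) (hm s) (abs_nonneg _) ((abs_nonneg _).trans (hp s))
          _ = δ * (L / 2) * p₂ s := by ring
    _ = δ / 2 * L := by rw [integral_const_mul, hp₂1]; ring

/-- **Oscillation bound for tilts** (Georgii 2011, Prop. 8.8; Föllmer 1988, Ch. I, Remark (2.17)):
for a probability measure `μ`, bounded measurable `h₁, h₂ : S → ℝ` with `|h₁ − h₂ − κ| ≤ ε`
pointwise for some constant `κ`, and a bounded measurable `φ` with oscillation `≤ L`
(`|φ a − φ b| ≤ L`), the tilted measures satisfy
`|∫ φ dμ^{h₁} − ∫ φ dμ^{h₂}| ≤ ½ (e^{2ε} − 1) L`. [cite: Georgii2011, Prop. 8.8] -/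
theorem abs_integral_tilted_sub_integral_tilted_le (μ : Measure S) [IsProbabilityMeasure μ]
    {h₁ h₂ : S → ℝ} (h1m : Measurable h₁) (h2m : Measurable h₂)
    (h1b : ∃ B, ∀ s, |h₁ s| ≤ B) (h2b : ∃ B, ∀ s, |h₂ s| ≤ B)
    {κ ε : ℝ} (hε : ∀ s, |h₁ s - h₂ s - κ| ≤ ε)
    {φ : S → ℝ} (hφm : Measurable φ) (hφb : ∃ M, ∀ s, |φ s| ≤ M)
    {L : ℝ} (hφL : ∀ a b, |φ a - φ b| ≤ L) :
    |∫ s, φ s ∂(μ.tilted h₁) - ∫ s, φ s ∂(μ.tilted h₂)| ≤ (exp (2 * ε) - 1) / 2 * L := by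
  have I₁ := integrable_exp_of_abs_le μ h1m h1b
  have I₂ := integrable_exp_of_abs_le μ h2m h2b
  have hZ₁ : 0 < ∫ s, exp (h₁ s) ∂μ := integral_exp_pos I₁
  have hZ₂ : 0 < ∫ s, exp (h₂ s) ∂μ := integral_exp_pos I₂
  have hZu : ∫ s, exp (h₁ s) ∂μ ≤ exp (κ + ε) * ∫ s, exp (h₂ s) ∂μ := by
    rw [← integral_const_mul]
    refine integral_mono I₁ (I₂.const_mul _) fun s => ?_
    show exp (h₁ s) ≤ exp (κ + ε) * exp (h₂ s)
    rw [← exp_add, exp_le_exp]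
    have := (abs_le.mp (hε s)).2
    linarith
  have hZl : exp (κ - ε) * ∫ s, exp (h₂ s) ∂μ ≤ ∫ s, exp (h₁ s) ∂μ := by
    rw [← integral_const_mul]
    refine integral_mono (I₂.const_mul _) I₁ fun s => ?_
    show exp (κ - ε) * exp (h₂ s) ≤ exp (h₁ s)
    rw [← exp_add, exp_le_exp]
    have := (abs_le.mp (hε s)).1
    linarith
  obtain ⟨M, hM⟩ := hφb
  obtain ⟨m, hm⟩ := exists_forall_abs_sub_le_half ⟨M, hM⟩ hφL
  have hφbd : ∀ᵐ s ∂μ, ‖φ s‖ ≤ M := ae_of_all _ fun s => by rw [Real.norm_eq_abs]; exact hM s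
  rw [integral_tilted, integral_tilted]
  simp only [smul_eq_mul]
  exact abs_integral_mul_sub_integral_mul_le μ (I₁.div_const _) (I₂.div_const _)
    ((I₁.div_const _).mul_bdd hφm.aestronglyMeasurable hφbd)
    ((I₂.div_const _).mul_bdd hφm.aestronglyMeasurable hφbd)
    (by rw [integral_div, div_self hZ₁.ne']) (by rw [integral_div, div_self hZ₂.ne'])
    (fun s => abs_exp_div_sub_exp_div_le hZ₁ hZ₂ (hε s) hZl hZu) hm

end Literature.Probability.LatticeModels.DobrushinMetric
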